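import Literature.Algebra.Homology.OrderedCechRestrict
import HarnessLib

/-!
# Exactness of the links of the ordered Čech complex from the acyclicity of the Čech complex of
# the link cover (bridge between `OrderedCech.LinkExact` and `OrderedCech.complex`)

`Literature/Algebra/Homology/OrderedCechRestrict` proves that the restriction of the ordered Čech
complex `Č•(F)` of a monotone family `F : Finset ι → Submodule A 𝕂` to a sub-cover `e : κ ↪o ι` is
a quasi-isomorphism as soon as all **links** are exact (`OrderedCech.quasiIso_restrictMap`,
hypothesis `OrderedCech.LinkExact F J t` for the non-empty `t` disjoint from `J = e(κ)`): the
link of `t` is the augmented complex `m ↦ Π_{s ⊆ J, #s = m} F (t ∪ s)` written on raw functions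
`Finset ι → 𝕂` with the differential `(δ_t c)(u) = Σ_{a ∈ u} ε(t ∪ u, a) c(u ∖ a)`
(`OrderedCech.linkD`) — the signs being those of the ambient simplex `t ∪ u`. For
`F s = Γ(W_s, 𝓕)` this is the augmented Čech complex of `𝓕|_{W_t}` for the cover
`(W_t ∩ W_j)_{j ∈ J}`, whose exactness (Görtz–Wedhorn II, Lemma 22.1) is naturally proved for the
honest ordered Čech complex of the family `s' ↦ F (t ∪ s')` on the index type `J`
(`OrderedCech.linkFamily`; for `𝒪_X(D)` this is
`Literature/AlgebraicGeometry/Motives/CartierDivisorCechAffine`, `exactAt_complex_cechFamily` and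
`iInf_cechFamily_singleton_eq`). This file PROVES the translation:

* `OrderedCech.twist t u = Π_{a ∈ u} (-1)^{#{b ∈ t ; b < a}}` and
  `OrderedCech.twist_mul_sign_union`: `θ_t(u) ε(t ∪ u, a) = ε(u, a) θ_t(u ∖ a)` for `t`, `u`
  disjoint — so `δ_t = θ_t⁻¹ ∘ d ∘ θ_t` with `d` the Čech differential in the `u`-vertices;
* `OrderedCech.linkExact_of_forall_exists_d_eq`, `OrderedCech.linkExact_of_exactAt` — **if the
  ordered Čech complex of `linkFamily F J t` is exact in all degrees `≠ 0` and
  `⋂_{j ∈ J} F (t ∪ {j}) ⊆ F t` (`Ȟ⁰` of the link cover is `F t`, the sheaf axiom), then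
  `LinkExact F J t`** (`J ≠ ∅`, `t ∩ J = ∅`): a link cocycle `c` in degree `m ≥ 1` becomes the
  Čech cocycle `γ_{s'} = θ_t(s') c(s')`, a primitive `β` of `γ` (or, for `m = 1`, the common value
  of the `0`-cocycle `γ`, which lies in `F t`) gives the link primitive `b(s) = θ_t(s) β(s)`;
  degree `m = 0` is the injectivity of `F t → Π_j F (t ∪ {j})` (inclusions).

Everything is proved; no named facts. With `OrderedCech.quasiIso_restrictMap` this reduces the
comparison of the Čech complexes of two affine covers (Görtz–Wedhorn II, Thm. 22.9) to the
acyclicity of Čech complexes on the affine pieces (Lemma 22.1), in the form proved for `𝒪_X(D)`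
in `Motives/CartierDivisorCechAffine`. Mathlib searched (pin): `Finset.subtype_map_of_mem`,
`Finset.mem_subtype`, `Finset.map_erase`, `Finset.sum_map`, `Finset.filter_union`,
`Finset.disjoint_filter_filter`, `Finset.mul_prod_erase` (used).

## References

* U. Görtz, T. Wedhorn, *Algebraic Geometry II: Cohomology of Schemes*, Springer Spektrum (2023),
  doi:10.1007/978-3-658-43031-3: Def. 21.68, Prop. 21.69, p. 260; Lemma 22.1, p. 327; Thm. 22.9,
  p. 332 (read via the held copy). [GortzWedhorn2023]
* The Stacks Project, Tag 01FG (ordered/alternating Čech complexes). [StacksProject]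
-/

universe u v

open CategoryTheory Finset

namespace Literature.Algebra.Homology

namespace OrderedCech

variable {ι : Type} [LinearOrder ι]
variable {A : Type u} [CommRing A]

/-! ### The sign twist between the link differential and the Čech differential -/

/-- A sign squared is one, in the form `ε (ε x) = x` for the action on a module. [folklore] -/
theorem neg_one_pow_mul_neg_one_pow_mul (n : ℕ) (y : A) : (-1 : A) ^ n * ((-1 : A) ^ n * y) = y := by
  rw [← mul_assoc, ← mul_pow, neg_one_mul, neg_neg, one_pow, one_mul]

/-- **The sign twist** `θ_t(u) = Π_{a ∈ u} (-1)^{#{b ∈ t ; b < a}}` relating the link differential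
of `t` (signs of the ambient simplex `t ∪ u`) to the Čech differential in the `u`-vertices.
[folklore] -/
def twist (t u : Finset ι) : A := ∏ a ∈ u, (-1 : A) ^ (t.filter (· < a)).card

/-- `θ_t(u)² = 1`. [folklore] -/
theorem twist_mul_self (t u : Finset ι) : twist (A := A) t u * twist t u = 1 := by
  rw [twist, ← Finset.prod_mul_distrib]
  refine Finset.prod_eq_one fun a _ => ?_
  rw [← mul_pow, neg_one_mul, neg_neg, one_pow]

/-- `θ θ x = x` for the action on a module. [folklore] -/
theorem twist_smul_twist_smul {𝕂 : Type v} [AddCommGroup 𝕂] [Module A 𝕂] (t u : Finset ι)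
    (x : 𝕂) : twist (A := A) t u • twist (A := A) t u • x = x := by
  rw [smul_smul, twist_mul_self, one_smul]

/-- `θ_t(∅) = 1`. [folklore] -/
@[simp] theorem twist_empty (t : Finset ι) : twist (A := A) t ∅ = 1 := Finset.prod_empty

/-- `θ_t({j}) = (-1)^{#{b ∈ t ; b < j}}`. [folklore] -/
theorem twist_singleton (t : Finset ι) (j : ι) :
    twist (A := A) t {j} = (-1 : A) ^ (t.filter (· < j)).card := Finset.prod_singleton _ _

/-- Removing a vertex: `(-1)^{#{b ∈ t ; b < a}} θ_t(u ∖ a) = θ_t(u)` for `a ∈ u`. [folklore] -/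
theorem neg_one_pow_mul_twist_erase (t : Finset ι) {u : Finset ι} {a : ι} (ha : a ∈ u) :
    (-1 : A) ^ (t.filter (· < a)).card * twist t (u.erase a) = twist t u :=
  Finset.mul_prod_erase u (fun a => (-1 : A) ^ (t.filter (· < a)).card) ha

/-- **The signs of the ambient simplex**: `ε(t ∪ u, a) = (-1)^{#{b ∈ t ; b < a}} ε(u, a)` for
`a ∈ u`, `t ∩ u = ∅`. [folklore] -/
theorem sign_union_of_disjoint {t u : Finset ι} (htu : Disjoint t u) (a : ι) :
    sign A (t ∪ u) a = (-1 : A) ^ (t.filter (· < a)).card * sign A u a := by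
  unfold sign
  rw [Finset.filter_union, Finset.card_union_of_disjoint (Finset.disjoint_filter_filter htu),
    pow_add]

/-- **`θ_t(u) ε(t ∪ u, a) = ε(u, a) θ_t(u ∖ a)`** (`a ∈ u`, `t ∩ u = ∅`): conjugation by the twist
turns the link differential into the Čech differential. [folklore] -/
theorem twist_mul_sign_union {t u : Finset ι} (htu : Disjoint t u) {a : ι} (ha : a ∈ u) :
    twist t u * sign A (t ∪ u) a = sign A u a * twist t (u.erase a) := by
  rw [sign_union_of_disjoint htu, ← neg_one_pow_mul_twist_erase t ha]
  have h := neg_one_pow_mul_neg_one_pow_mul (A := A) (t.filter (· < a)).card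
    (sign A u a * twist t (u.erase a))
  calc (-1 : A) ^ (t.filter (· < a)).card * twist t (u.erase a) *
        ((-1 : A) ^ (t.filter (· < a)).card * sign A u a)
        = (-1 : A) ^ (t.filter (· < a)).card *
            ((-1 : A) ^ (t.filter (· < a)).card * (sign A u a * twist t (u.erase a))) := by ring
    _ = sign A u a * twist t (u.erase a) := h

/-- **`ε(t ∪ u, a) θ_t(u ∖ a) = θ_t(u) ε(u, a)`** (`a ∈ u`, `t ∩ u = ∅`), the same identity read
from the other side. [folklore] -/
theorem sign_union_mul_twist_erase {t u : Finset ι} (htu : Disjoint t u) {a : ι} (ha : a ∈ u) :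
    sign A (t ∪ u) a * twist t (u.erase a) = twist t u * sign A u a := by
  rw [sign_union_of_disjoint htu, ← neg_one_pow_mul_twist_erase t ha]
  ring

/-! ### The link family on the index type `J` -/

variable {𝕂 : Type v} [AddCommGroup 𝕂] [Module A 𝕂]
variable (F : Finset ι → Submodule A 𝕂) (J t : Finset ι)

/-- **The link family of `t` over `J`**: `s' ↦ F (t ∪ s')` on the finite subsets `s'` of (the type
of) `J` — for `F s = Γ(W_s, 𝓕)` the sections of `𝓕|_{W_t}` on the intersections of the cover
`(W_t ∩ W_j)_{j ∈ J}` of `W_t`. [folklore] -/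
def linkFamily : Finset ↥J → Submodule A 𝕂 :=
  fun s' => F (t ∪ s'.map (Function.Embedding.subtype _))

/-- Unfolding of `linkFamily`. [folklore] -/
@[simp] theorem linkFamily_apply (s' : Finset ↥J) :
    linkFamily F J t s' = F (t ∪ s'.map (Function.Embedding.subtype _)) := rfl

variable {F} in
/-- The link family is monotone. [folklore] -/
theorem linkFamily_mono (hF : Monotone F) : Monotone (linkFamily F J t) := fun _ _ h =>
  hF (Finset.union_subset_union le_rfl (Finset.map_subset_map.2 h))

omit [LinearOrder ι] in
/-- Finite subsets of `J` pushed into `ι` lie in `J`. [folklore] -/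
theorem map_subtype_subset (s' : Finset ↥J) : s'.map (Function.Embedding.subtype _) ⊆ J :=
  fun _ hx => Finset.property_of_mem_map_subtype s' hx

/-- Signs on the index type `J` are the signs in `ι`. [folklore] -/
theorem sign_subtype (s' : Finset ↥J) (a' : ↥J) :
    sign A s' a' = sign A (s'.map (Function.Embedding.subtype _)) (a' : ι) :=
  (sign_map (OrderEmbedding.subtype (· ∈ J)) s' a').symm

/-- For `a ∈ s ⊆ J`: `(s ∖ a)` pulled back to `J` is the pull-back of `s` minus `a`. [folklore] -/
theorem subtype_erase [DecidableEq ↥J] {s : Finset ι} {a : ι} (ha : a ∈ J) :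
    (s.erase a).subtype (· ∈ J) = (s.subtype (· ∈ J)).erase ⟨a, ha⟩ := by
  ext x
  simp only [Finset.mem_subtype, Finset.mem_erase, ne_eq]
  constructor
  · rintro ⟨hxa, hxs⟩
    exact ⟨fun h => hxa (by rw [h]), hxs⟩
  · rintro ⟨hxa, hxs⟩
    exact ⟨fun h => hxa (Subtype.ext h), hxs⟩

/-! ### Exactness of `OrderedCech.complex` gives primitives of cocycles -/

variable {F J t}

/-- From `ExactAt` to the solvability of `d b = c` for cocycles (converse bookkeeping of
`OrderedCech.exactAt_of_forall_exists_d_eq`). [folklore] -/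
theorem exists_d_eq_of_exactAt {κ : Type} [LinearOrder κ] {G : Finset κ → Submodule A 𝕂}
    (hG : Monotone G) {n : ℤ} (h : (complex G hG).ExactAt (n + 1)) (c : Cochain G (n + 1))
    (hc : d G hG (n + 1) c = 0) : ∃ b : Cochain G n, d G hG n b = c := by
  rw [HomologicalComplex.exactAt_iff' _ (n + 1) (i := n) (k := n + 1 + 1) (by simp) (by simp),
    ShortComplex.moduleCat_exact_iff] at h
  obtain ⟨b, hb⟩ := h c (by
    change ((complex G hG).d (n + 1) (n + 1 + 1)) c = 0
    rw [complex_d]; exact hc)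
  refine ⟨b, ?_⟩
  change ((complex G hG).d n (n + 1)) b = c at hb
  rwa [complex_d] at hb

/-! ### From the Čech complex of the link cover to `LinkExact` -/

/-- **The twisted cochain of a link cocycle**: a function `c` supported on the `s ⊆ J` with
`#s = m`, `c s ∈ F (t ∪ s)`, which is a cocycle for `δ_t` in degree `m = q + 1 ≥ 1`, gives the
Čech cocycle `γ_{s'} = θ_t(s') c(s')` of degree `q` of the link family. [folklore] -/
theorem exists_cochain_of_link (hF : Monotone F) (htJ : Disjoint t J) {m : ℕ} (hm : 1 ≤ m) {q : ℤ}
    (hq : (m : ℤ) = q + 1) (c : Finset ι → 𝕂) (hsupp : ∀ s, c s ≠ 0 → s ⊆ J ∧ s.card = m)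
    (hmem : ∀ s, c s ∈ F (t ∪ s))
    (hcyc : ∀ u, u ⊆ J → u.card = m + 1 → linkD (A := A) t c u = 0) :
    ∃ γ : Cochain (linkFamily F J t) q,
      (∀ s' : Finset ↥J, γ.ext0 s' =
        twist (A := A) t (s'.map (Function.Embedding.subtype _)) •
          c (s'.map (Function.Embedding.subtype _))) ∧
      d (linkFamily F J t) (linkFamily_mono J t hF) q γ = 0 := by
  classical
  have hc0 : ∀ s, ¬ (s ⊆ J ∧ s.card = m) → c s = 0 := fun s hs => by
    by_contra h; exact hs (hsupp s h)
  let γ : Cochain (linkFamily F J t) q := fun σ =>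
    ⟨twist (A := A) t (σ.1.map (Function.Embedding.subtype (· ∈ J))) •
        c (σ.1.map (Function.Embedding.subtype (· ∈ J))), Submodule.smul_mem _ _ (hmem _)⟩
  have hγ : ∀ s' : Finset ↥J, γ.ext0 s' =
      twist (A := A) t (s'.map (Function.Embedding.subtype (· ∈ J))) •
        c (s'.map (Function.Embedding.subtype (· ∈ J))) := by
    intro s'
    by_cases hs' : s'.Nonempty ∧ (s'.card : ℤ) = q + 1
    · exact Cochain.ext0_val γ ⟨s', hs'⟩
    · have hcard : (s'.card : ℤ) ≠ q + 1 := by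
        intro h
        refine hs' ⟨Finset.card_pos.1 ?_, h⟩
        have : (s'.card : ℤ) = m := by rw [h, hq]
        omega
      rw [Cochain.ext0_of_card_ne γ s' hcard, hc0, smul_zero]
      rintro ⟨-, hm'⟩
      apply hcard
      rw [← hq, ← hm', Finset.card_map]
  refine ⟨γ, hγ, ?_⟩
  funext τ
  apply Subtype.ext
  rw [coe_d_apply]
  change ∑ a' ∈ τ.1, sign A τ.1 a' • γ.ext0 (τ.1.erase a') = 0
  have huJ : τ.1.map (Function.Embedding.subtype (· ∈ J)) ⊆ J := map_subtype_subset J τ.1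
  have htu : Disjoint t (τ.1.map (Function.Embedding.subtype (· ∈ J))) := htJ.mono_right huJ
  have hucard : (τ.1.map (Function.Embedding.subtype (· ∈ J))).card = m + 1 := by
    have h1 : (τ.1.card : ℤ) = q + 1 + 1 := τ.2.2
    have h2 : (τ.1.map (Function.Embedding.subtype (· ∈ J))).card = τ.1.card := Finset.card_map _
    omega
  have key : ∀ a' ∈ τ.1, sign A τ.1 a' • γ.ext0 (τ.1.erase a') =
      (fun a : ι => twist (A := A) t (τ.1.map (Function.Embedding.subtype (· ∈ J))) •
        (sign A (t ∪ τ.1.map (Function.Embedding.subtype (· ∈ J))) a •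
          c ((τ.1.map (Function.Embedding.subtype (· ∈ J))).erase a)))
        ((Function.Embedding.subtype (· ∈ J)) a') := by
    intro a' ha'
    have hmem' : (Function.Embedding.subtype (· ∈ J)) a' ∈
        τ.1.map (Function.Embedding.subtype (· ∈ J)) := Finset.mem_map_of_mem _ ha'
    rw [hγ, Finset.map_erase, sign_subtype, smul_smul]
    change _ = twist (A := A) t (τ.1.map (Function.Embedding.subtype (· ∈ J))) •
        (sign A (t ∪ τ.1.map (Function.Embedding.subtype (· ∈ J)))
            ((Function.Embedding.subtype (· ∈ J)) a') •
          c ((τ.1.map (Function.Embedding.subtype (· ∈ J))).erase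
            ((Function.Embedding.subtype (· ∈ J)) a')))
    rw [smul_smul, twist_mul_sign_union htu hmem']
    rfl
  rw [Finset.sum_congr rfl key,
    ← Finset.sum_map τ.1 (Function.Embedding.subtype (· ∈ J))
      (fun a : ι => twist (A := A) t (τ.1.map (Function.Embedding.subtype (· ∈ J))) •
        (sign A (t ∪ τ.1.map (Function.Embedding.subtype (· ∈ J))) a •
          c ((τ.1.map (Function.Embedding.subtype (· ∈ J))).erase a))),
    ← Finset.smul_sum, ← linkD_apply, hcyc _ huJ hucard, smul_zero]

/-- **Exactness of the link from the acyclicity of the Čech complex of the link cover**, with the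
hypotheses in elementwise form: if `J ≠ ∅`, `t ∩ J = ∅`, every positive-degree cocycle of the
ordered Čech complex of `linkFamily F J t` is a coboundary, and `⋂_{j ∈ J} F (t ∪ {j}) ⊆ F t`, then
`LinkExact F J t` (the link differential is conjugate to the Čech differential by the twist
`θ_t`). For `F s = Γ(W_s, 𝓕)`: the augmented Čech complex of `𝓕|_{W_t}` for the cover
`(W_t ∩ W_j)_{j ∈ J}` is exact as soon as its Čech complex is acyclic and `Ȟ⁰ = Γ(W_t, 𝓕)`
(Görtz–Wedhorn II, Lemma 22.1 for `W_t` affine). [cite: GortzWedhorn2023, Lemma 22.1 (p. 327)] -/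
theorem linkExact_of_forall_exists_d_eq (hF : Monotone F) (hJ : J.Nonempty) (htJ : Disjoint t J)
    (h0 : ∀ x : 𝕂, (∀ j ∈ J, x ∈ F (t ∪ {j})) → x ∈ F t)
    (hex : ∀ n : ℤ, 0 ≤ n → ∀ c : Cochain (linkFamily F J t) (n + 1),
      d (linkFamily F J t) (linkFamily_mono J t hF) (n + 1) c = 0 →
      ∃ b : Cochain (linkFamily F J t) n, d (linkFamily F J t) (linkFamily_mono J t hF) n b = c) :
    LinkExact (A := A) F J t := by
  classical
  intro m c hsupp hmem hcyc
  have hc0 : ∀ s, ¬ (s ⊆ J ∧ s.card = m) → c s = 0 := fun s hs => by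
    by_contra h; exact hs (hsupp s h)
  obtain ⟨j₀, hj₀⟩ := hJ
  rcases Nat.lt_trichotomy m 1 with hm | rfl | hm
  · -- `m = 0`: the cocycle condition on the singletons kills `c ∅`, so `c = 0` and `b = 0`
    obtain rfl : m = 0 := by omega
    have hce : c ∅ = 0 := by
      have h1 := hcyc {j₀} (Finset.singleton_subset_iff.2 hj₀) (by simp)
      rw [linkD_apply, Finset.sum_singleton, Finset.erase_singleton] at h1
      have h2 := congrArg (fun x => sign A (t ∪ {j₀}) j₀ • x) h1
      simp only [smul_smul, sign_mul_sign_self, one_smul, smul_zero] at h2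
      exact h2
    have hcz : ∀ s, c s = 0 := fun s => by
      by_cases hs : s ⊆ J ∧ s.card = 0
      · rw [Finset.card_eq_zero.1 hs.2]; exact hce
      · exact hc0 s hs
    refine ⟨0, fun s hs => absurd rfl hs, fun s => (F (t ∪ s)).zero_mem, fun s _ _ => ?_⟩
    rw [map_zero, hcz]
    rfl
  · -- `m = 1`: the `0`-cocycle `γ` is constant, its value lies in `F t`
    obtain ⟨γ, hγ, hdγ⟩ := exists_cochain_of_link hF htJ (m := 1) le_rfl (q := 0) (by norm_num) c
      hsupp hmem hcyc
    have hconst := (d_zero_eq_zero_iff _ (linkFamily_mono J t hF) γ).1 hdγ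
    set x : 𝕂 := (γ (vertex ⟨j₀, hj₀⟩) : 𝕂) with hx
    -- the value of `γ` at the vertex `j` is `θ_t({j}) c {j}`
    have hγv : ∀ (j : ι) (hj : j ∈ J), (γ (vertex ⟨j, hj⟩) : 𝕂) = twist (A := A) t {j} • c {j} := by
      intro j hj
      rw [← Cochain.ext0_val, vertex_val, hγ, Finset.map_singleton]
      rfl
    have hxj : ∀ (j : ι) (hj : j ∈ J), x = twist (A := A) t {j} • c {j} := fun j hj => by
      rw [hx, hconst ⟨j₀, hj₀⟩ ⟨j, hj⟩, hγv j hj]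
    have hxt : x ∈ F t := by
      refine h0 x fun j hj => ?_
      rw [hxj j hj]
      exact Submodule.smul_mem _ _ (hmem {j})
    let b : Finset ι → 𝕂 := fun s => if s = ∅ then x else 0
    have hb0 : b ∅ = x := if_pos rfl
    have hbne : ∀ s, s ≠ ∅ → b s = 0 := fun s hs => if_neg hs
    refine ⟨b, fun s hs => ?_, fun s => ?_, fun s hsJ hs1 => ?_⟩
    · by_cases h : s = ∅
      · subst h; exact ⟨Finset.empty_subset _, rfl⟩
      · exact absurd (hbne s h) hs
    · by_cases h : s = ∅
      · subst h; rw [hb0, Finset.union_empty]; exact hxt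
      · rw [hbne s h]; exact zero_mem _
    · obtain ⟨j, rfl⟩ := Finset.card_eq_one.1 hs1
      have hj : j ∈ J := hsJ (Finset.mem_singleton_self j)
      have htj : Disjoint t {j} :=
        Finset.disjoint_singleton_right.2 fun hjt => Finset.disjoint_left.1 htJ hjt hj
      rw [linkD_apply, Finset.sum_singleton, Finset.erase_singleton, hb0, hxj j hj, smul_smul,
        sign_union_of_disjoint htj]
      unfold sign
      rw [show ({j} : Finset ι).filter (· < j) = ∅ from by
          ext a
          simp only [Finset.mem_filter, Finset.mem_singleton, Finset.notMem_empty, iff_false, not_and]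
          rintro rfl
          exact lt_irrefl _,
        Finset.card_empty, pow_zero, mul_one, ← twist_singleton, twist_mul_self, one_smul]
  · -- `m = n + 2`: a primitive `β` of the twisted cocycle `γ` gives `b(s) = θ_t(s) β(s)`
    obtain ⟨n, rfl⟩ : ∃ n : ℕ, m = n + 2 := ⟨m - 2, by omega⟩
    obtain ⟨γ, hγ, hdγ⟩ := exists_cochain_of_link hF htJ (m := n + 2) (by omega) (q := (n : ℤ) + 1)
      (by push_cast; ring) c hsupp hmem hcyc
    obtain ⟨β, hβ⟩ := hex n (by omega) γ hdγ
    -- `β` vanishes off the sets with `n + 1` elements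
    have hβ0 : ∀ s' : Finset ↥J, s'.card ≠ n + 1 → β.ext0 s' = 0 := fun s' hs' =>
      Cochain.ext0_of_card_ne β s' fun h => hs' (by exact_mod_cast h)
    let b : Finset ι → 𝕂 := fun s =>
      if s ⊆ J then twist (A := A) t s • β.ext0 (s.subtype (· ∈ J)) else 0
    have hb : ∀ s, s ⊆ J → b s = twist (A := A) t s • β.ext0 (s.subtype (· ∈ J)) :=
      fun s hs => if_pos hs
    have hsub : ∀ s, s ⊆ J → (s.subtype (· ∈ J)).map (Function.Embedding.subtype (· ∈ J)) = s :=
      fun s hs => Finset.subtype_map_of_mem fun x hx => hs hx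
    have hcard : ∀ s, s ⊆ J → (s.subtype (· ∈ J)).card = s.card := fun s hs => by
      conv_rhs => rw [← hsub s hs, Finset.card_map]
    refine ⟨b, fun s hs => ?_, fun s => ?_, fun s₀ hs₀J hs₀ => ?_⟩
    · -- support
      by_cases hsJ : s ⊆ J
      · refine ⟨hsJ, ?_⟩
        by_contra hne
        apply hs
        rw [hb s hsJ, hβ0 _ (by rw [hcard s hsJ]; omega), smul_zero]
      · exact absurd (if_neg hsJ) hs
    · -- membership
      by_cases hsJ : s ⊆ J
      · rw [hb s hsJ]
        refine Submodule.smul_mem _ _ ?_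
        have hm' := Cochain.ext0_mem β (s.subtype (· ∈ J))
        rw [linkFamily_apply, hsub s hsJ] at hm'
        exact hm'
      · rw [show b s = 0 from if_neg hsJ]
        exact zero_mem _
    · -- `δ_t b = c` on the `s₀ ⊆ J` with `n + 2` elements
      have hts₀ : Disjoint t s₀ := htJ.mono_right hs₀J
      set σ₀ : Simplex ↥J ((n : ℤ) + 1) := ⟨s₀.subtype (· ∈ J),
        Finset.card_pos.1 (by rw [hcard s₀ hs₀J]; omega),
        by rw [hcard s₀ hs₀J, hs₀]; push_cast; ring⟩ with hσ₀
      -- `(d β)(σ₀) = γ(σ₀) = θ c(s₀)`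
      have hdβ : ((d (linkFamily F J t) (linkFamily_mono J t hF) n β) σ₀ : 𝕂) =
          twist (A := A) t s₀ • c s₀ := by
        rw [hβ, ← Cochain.ext0_val, hγ]
        change twist (A := A) t ((s₀.subtype (· ∈ J)).map (Function.Embedding.subtype (· ∈ J))) •
          c ((s₀.subtype (· ∈ J)).map (Function.Embedding.subtype (· ∈ J))) = _
        rw [hsub s₀ hs₀J]
      rw [coe_d_apply] at hdβ
      change ∑ a' ∈ s₀.subtype (· ∈ J), sign A (s₀.subtype (· ∈ J)) a' •
        β.ext0 ((s₀.subtype (· ∈ J)).erase a') = _ at hdβ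
      -- rewrite the sum over `s₀.subtype` as a sum over `s₀`
      have hsum : ∑ a' ∈ s₀.subtype (· ∈ J), sign A (s₀.subtype (· ∈ J)) a' •
            β.ext0 ((s₀.subtype (· ∈ J)).erase a') =
          ∑ a ∈ s₀, sign A s₀ a • β.ext0 ((s₀.erase a).subtype (· ∈ J)) := by
        have key : ∀ a' ∈ s₀.subtype (· ∈ J), sign A (s₀.subtype (· ∈ J)) a' •
            β.ext0 ((s₀.subtype (· ∈ J)).erase a') =
            (fun a : ι => sign A s₀ a • β.ext0 ((s₀.erase a).subtype (· ∈ J)))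
              ((Function.Embedding.subtype (· ∈ J)) a') := by
          intro a' _
          change _ = sign A s₀ (a' : ι) • β.ext0 ((s₀.erase (a' : ι)).subtype (· ∈ J))
          rw [sign_subtype, hsub s₀ hs₀J, subtype_erase J a'.2]
        rw [Finset.sum_congr rfl key,
          ← Finset.sum_map (s₀.subtype (· ∈ J)) (Function.Embedding.subtype (· ∈ J))
            (fun a : ι => sign A s₀ a • β.ext0 ((s₀.erase a).subtype (· ∈ J))),
          hsub s₀ hs₀J]
      rw [hsum] at hdβ
      -- expand `δ_t b` and compare
      rw [linkD_apply]
      calc ∑ a ∈ s₀, sign A (t ∪ s₀) a • b (s₀.erase a)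
          = ∑ a ∈ s₀, twist (A := A) t s₀ •
              (sign A s₀ a • β.ext0 ((s₀.erase a).subtype (· ∈ J))) := by
            refine Finset.sum_congr rfl fun a ha => ?_
            rw [hb _ ((Finset.erase_subset a s₀).trans hs₀J), smul_smul, smul_smul,
              sign_union_mul_twist_erase hts₀ ha]
        _ = twist (A := A) t s₀ • (twist (A := A) t s₀ • c s₀) := by rw [← Finset.smul_sum, hdβ]
        _ = c s₀ := twist_smul_twist_smul t s₀ (c s₀)

/-- **Exactness of the link from the acyclicity of the Čech complex of the link cover**
(`HomologicalComplex.ExactAt` form): if `J ≠ ∅`, `t ∩ J = ∅`, the ordered Čech complex of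
`linkFamily F J t` is exact in every degree `≠ 0`, and `⋂_{j ∈ J} F (t ∪ {j}) ⊆ F t`, then
`LinkExact F J t` — the hypothesis of `OrderedCech.quasiIso_restrictMap` for `t`
(Görtz–Wedhorn II, Lemma 22.1 ⟹ Thm. 22.9). [cite: GortzWedhorn2023, Lemma 22.1 (p. 327) and Thm. 22.9 (p. 332)] -/
theorem linkExact_of_exactAt (hF : Monotone F) (hJ : J.Nonempty) (htJ : Disjoint t J)
    (h0 : ∀ x : 𝕂, (∀ j ∈ J, x ∈ F (t ∪ {j})) → x ∈ F t)
    (hex : ∀ m : ℤ, m ≠ 0 →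
      (complex (linkFamily F J t) (linkFamily_mono J t hF)).ExactAt m) :
    LinkExact (A := A) F J t :=
  linkExact_of_forall_exists_d_eq hF hJ htJ h0 fun n hn c hc =>
    exists_d_eq_of_exactAt (linkFamily_mono J t hF) (hex (n + 1) (by omega)) c hc

end OrderedCech

end Literature.Algebra.Homology
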